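import Summits.ResolutionOfSingularities.ResolutionOfSingularities.Theorems.OddCrossCutCells
import Summits.ResolutionOfSingularities.ResolutionOfSingularities.Theorems.SpreadCutLaw3
import HarnessLib

/-!
# CuspCutKernels — decomp-res node «CuspCut» (lens-2 g24, critic row 197 BOOKED 0), tree file 1/6 of the node

Content VERBATIM from the decomp-res lens-2 g24 node `HOME/decomp-res-lens-2/g24/CuspCut.lean` (pin 4f3dedd1, 1300
l; parts pinned in `parts/SHA256SUMS`; HOME = run/shared/lean/pub/decomp-res): NO carry — the node imports the
LANDED tree only (`…Theorems.MaxContactCutOddCrossCut`, `…Theorems.OddCrossCutCells`, `…Theorems.SpreadCutLaw3`);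
every declaration is new; namespace `…Theses.CuspCut` ↦ `…Theorems.CuspCut` (same renaming as OddCrossCut, rows
180/184).  Farm (node; lens + critic runs): rc 0 · 0 warn · 0 sorry · axioms std; Probe 0 failures.  Critic:
CRITIC-LEDGER row 197 «CuspCut» BOOKED 0 (content lands at 0-weight as cells / kernels: the E** law of the lens-2
column — cusp letters `EdgeAbove` / `RelCusp` / `CuspShape`, the INSEP-v³ tower, the KERNEL CERTIFICATE of the
inhabitant's exit package (`section Pilot`: 39 chart identities + 21 leaf certificates of the ω-game run by rule 𝓡
on `F = u s⁵ + u t³ + u³`), the tame pilot corner39 (`section Corner`), the scheme-level cusp class WITH TAILS and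
the ENGINES `CuspExit` / `TameTwoExit` (untagged `def … : Prop` HYPOTHESES by name, same advisory treatment as
`DeepCrossExit`), the cut `cuspLeaf = oddLeaf ∨ (E**)` and the located residual class `IsCuspSpecialPt` /
`CuspX.CuspSpecialRung`).  Landing orders = the lens LANDING NOTE INBOX :1164 endorsed by the critic rider INBOX
:1194: (K) `CuspCutKernels*` = §E.0 + §E.0b + §E.0c + §E.0d (ring level; imports `OddCrossCutCells` +
`SpreadCutLaw3` + HarnessLib — the cone module `MaxContactCutOddCrossCut` is imported only by (M)), (C)
`CuspCutCells*` = §E.1 / §E.1t / §E.2 + the cone-free part of `namespace CuspX` (§E.2b graded statements, §E.2c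
kernels that do not name the host route) — the cone-free ASIDE HOME of `CuspX.CuspGenericRung` /
`CuspX.CuspSpecialRung`, (M) `MaxContactCutCuspCut` = the `CuspX` wiring BY NAME on the host route (`rungOne_iff`,
`closes`, `closes_of_engines`, §E.3 exact re-locations incl. `leafSpecialRung_iff_cuspSpecialRung`); all VERBATIM,
`--kind proof --supports stmt-ResolutionOfSingularities-29273`; NO aside switch (lens-2's filed aside stays
`LeafSpecialRung` 33866, cone rule; 0-weight docstring patch of 33866 by `ledger patch`).  The `def … : Prop`
declarations (`RelCusp`, `CuspShape`, `IsCuspAt`, `IsUniformCuspCurve`, `CuspExit`, `IsCuspCurvePt`,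
`IsUniformTameCurve`, `TameTwoExit`, `IsTameCurvePt`, `IsCuspKindPt`, `IsCuspSpecialPt`, `CuspX.SeqCuspGen`,
`CuspX.SeqCuspSpec`, `CuspX.CuspGenRungAt`, `CuspX.CuspGenericRung`, `CuspX.CuspSpecialRung`) are THIS node's
letters / classes / cells / engines-as-hypotheses (cn26) — none is a vendored fact.

The lens header, verbatim:

> # CuspCut — decomp-res lens-2 g24 (structural dichotomy, residual mode): the E** law of the lens-2 column
>
> Target BY NAME (column of the lineage since g14): `Theses.MaxContactCut.RungOne = (E 2 → E 1)` (stmt 29273).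
> Located residual after g23 (now IN THE TREE: `Theorems.OddCrossCutCells`): `OddX.OddSpecialRung` /
> `IsOddSpecialPt`.  CRITIC-LEDGER row 184 WINDOW (binding), item (a): «an E** law deciding the WHOLE cuspidal-
> secondary-curve kind, INSEP-v³ the inhabitant».  This node imports the tree (no restated lens material) and adds:
>
> §E.0  RING LEVEL (any commutative ring; 0 sorry).  The CUSP LETTERS: `EdgeAbove`, `RelCusp` (at every point of
>       the fibre line the C-relative secondary curve is REGULAR (g19 `RelSimple`) OR has ONE COPRIME NEWTON EDGE
>       `(a,b)`, `a,b ≥ 2` — a unibranch cusp with κ-rational tangent), `CuspShape` (= g19 `SpreadShape` at marking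
>       `n = 2`, `m = 2q+1`, with `RelCusp` for `RelSimple`); kernels `relCusp_of_relSimple`,
>       `cuspShape_of_spreadShape` (the spread class is INSIDE the cusp class), `eq_span_X_sup_map`,
>       `relCusp_X_pow_add_C_pow` (THE LETTER OF THE INHABITANT: `X^a + t^b`, `M = (t) + P`),
>       `cuspShape_pure`; the INSEP-v³ TOWER `insepV3_frame` / `insepV3_stage1` / `insepV3_stage2`
>       (INSEP-v³ `= z̃² + u₁⁵ + v³u₂⁵ + u₂⁷`, `z̃ = z + v(u₁+u₂)`; after the two global blow-ups `C`, `Σ₁` of the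
>       g19 tower the strict transform at the cusp point `x̄ ∈ Σ₂` is `Z² + F`, `F = u·w⁵ + u·v³ + u³`);
>       and `section Pilot`: THE KERNEL CERTIFICATE OF THE INHABITANT's EXIT PACKAGE — the complete blow-up tree of
>       the ω-game (below) run by rule 𝓡 on `F = u s⁵ + u t³ + u³` (`s = w`, `t = v`): 40 nodes, 39 chart
>       identities `pilot_e<k>` (strict transform of `Z² + F_parent` in the chart = `x_j² · ((Z + H)² + F_child)`,
>       the square `H²` re-absorbed into `Z`; exact over ℤ or modulo `2 = 0`) and 21 leaf certificates
>       `pilot_leaf<k>` (an explicit combination of the six derivatives `∂_u F, ∂_s F, ∂_t F, D_us F, D_ut F,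
>       D_st F` — EXACT over ℤ and DISPLAYED (the mixed second derivatives are the Hasse ones; odd multiples
>       survive `2 = 0`, even ones die) — and, where needed, the product of the Λ-coordinates, EQUALS `1` given
>       `2 = 0`: no τ = 1 point of the chart lies over the curve).  The tree (node, `F`, Λ = exceptional components
>       through the chart with their local equations, move) is listed verbatim above `section Pilot`; branch-local
>       tags `E_k` = the component created at depth `k` of the branch.  READ GLOBALLY (NODE-g24 §3.3, checked by
>       hand chart by chart) the tree is the atlas of ONE sequence of 10 regular centres over the cusp point `x̄`:
>       R1 `x̄`; R2 `C₂ = S̃∩E₁` (`S̃` = strict transform of `Σ_q = {u=0}`); R3 `E₁∩E₂` and `S̃∩E₂` (disjoint);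
>       R4 `E₁∩E₃` and `E₂∩E₃` (disjoint; `E₃` over `E₁∩E₂`); R5 the fibre `Ψ` of `E₂` over `t = 0 ∈ C₂`; R6 the
>       section `A = E₂∩E_Ψ`; R7 the fibre `Φ` of `E₃'` (`E₃'` over `S̃∩E₂`) over `t = 0`; R8 the fibre `Θ` of `E_Ψ`
>       over the point `Ψ∩E₃'` — every later centre a `ℙ¹` inside the exceptional locus, each covered by the two
>       or three charts of the tree that blow it up (so regularity and permissibility are certified on a cover).
>       §E.0d `section Corner`: the same certificate for the TAME PILOT corner39 over `𝔽₃` (exact game; 8 nodes,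
>       2 rounds: `x̄`, then `S̃∩E₁`; `corner_root_top` / `corner_root_fat` / `corner_zroot`, `corner_e0…e6`,
>       `corner_leaf0…4` modulo `3 = 0`).
> §E.1  SCHEME LEVEL, the CLASS WITH TAILS and the ENGINE: `IsCuspAt I m η y` (regular parameters `c = (z̃,u₁,u₂)`
>       generating the curve prime, inert `v`, `spanFinrank 𝔪_y = 4`, PRINCIPAL `I_y = (f)`, `CuspShape`),
>       `IsUniformCuspCurve I n m η` (`n = 2`; `η` a curve point; at every closed point residue characteristic `2`
>       and `IsCuspAt`), the ENGINE `CuspExit` (uniform cusp curve + Top-isolated closure ⇒ `PackageExitsOver`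
>       over the curve), the DECIDED-SIDE CLASS `IsCuspCurvePt`, kernels `eq_two_of_isUniformCuspCurve`,
>       `isCurveExitPt_of_isCuspCurvePt` (under `CuspExit` every cusp-curve point is a curve-exit point of g12's
>       port — no new port).  §E.1t THE TAME HALF: `IsUniformTameCurve I n η` (`n = 2`; at every closed point residue
>       characteristic `≠ 2`, `I_y` principal of order 2 — no shape letter), the ENGINE `TameTwoExit`, the class
>       `IsTameCurvePt`, `not_isTameCurvePt_of_isCuspCurvePt` (the halves are disjoint at closed points),
>       `IsCuspKindPt = IsCuspCurvePt ∨ IsTameCurvePt` with `isCuspKindPt_iff_of_ringChar_eq_two` / `_ne_two`.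
> §E.2  THE CUSP CUT: `cuspLeaf = oddLeaf ∨ IsCuspKindPt`, order lemmas, the located residual class
>       `IsCuspSpecialPt = IsOddSpecialPt ∧ ¬ IsCuspKindPt`, `isSpecPt_cuspLeaf_iff`, the residual read on each side
>       `isCuspSpecialPt_iff_of_ringChar_eq_two` / `_ne_two`; `namespace CuspX`: graded
>       statements, rungs `CuspGenericRung` / `CuspSpecialRung` (THE NEW LOCATED RESIDUAL), `rungOne_iff`,
>       `closes : CuspGenericRung → CuspSpecialRung → MaxContactCut.RungOne` BY NAME, `isExitPt_of_cuspLeaf`,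
>       `cuspGenericRung_of_engines` / `_of_ports` (g23's engine list + `CuspExit` + `TameTwoExit`), `closes_of_engines`.
> §E.3  EXACT RE-LOCATION of the tree's `OddX.OddSpecialRung` (and of every earlier residual of the lineage and of
>       the tree aside `MaxContactCut.LeafSpecialRung`) modulo the cusp decided half: `oddSpecialRung_iff_cuspSpecialRung`,
>       `deepSpecialRung_iff_cuspSpecialRung`, …, `leafSpecialRung_iff_cuspSpecialRung`; hypothesis-free edges
>       `cuspSpecialRung_of_oddSpecialRung` (WEAKER BY LETTER), `oddGenericRung_of_cuspGenericRung`; `odd_closes_of_cusp`.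
>
> THE ω-GAME (paper half = HOME/decomp-res-lens-2/g24/NODE-g24.md §1–§5; marking 2, residue characteristic 2, the
> local hypersurface `f = Z² + F(u,s,t)` in a regular 4-fold, `F` read modulo squares):  Top(f,2) ≅ V(∇F);
> the τ = 1 locus is `V(∇F, D_us F, D_ut F, D_st F)` (mixed Hasse derivatives); a regular centre `V(Z, x_i : i ∈ A)`
> is permissible iff `F ∈ (x_i : i ∈ A)²`; its chart `x_j` replaces `F` by `F(σ_j x)/x_j²` (and the `Z`-chart carries
> no point over the centre); squares of monomials are re-absorbed into `Z`.  Only points over the curve — i.e. on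
> Λ = strict transform of `Σ_q` ∪ the new exceptional components — matter (`PackageExitsOver` quantifies there).
> RULE 𝓡 (intrinsic, by priority; NODE-g24 §2): `sq` an exceptional component `E` with `x_E² ∣ F` (blow up the
> surface `V(Z,x_E)`) > `dc` the intersection curve of the two OLDEST CARRIER components (`E` is a carrier iff
> `F|_E ≡ 0`, i.e. `I·𝒪_E` is the square of a regular divisor — intrinsic; such a curve is in Top and permissible)
> > `fc` a fat (τ = 1) curve > `tl` a regular Top-curve through a fat point inside an exceptional component (ranked by
> the number and age of the components containing it; ties — branches of a nodal double divisor — broken arbitrarily: every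
> tested tie-break terminates on the bed; absent from the pilot's tree) > `fp` a fat point.  GLOBAL FORM: a round
blows up simultaneously all centres of the top-priority class present (pairwise
> disjoint; ties inside a class by component age); structural classes `sq`/`dc` are followed in EVERY chart meeting
> the centre, clean charts included (the certificate's tree is generated in this global mode), so for `tl`-free trees —
>
> [… the lens header continues (34 more lines: the ω-game / rule 𝓡 in full, the pilot tree table, the tame half,
what (E**) does not decide, why-novel) in the HOME node file `HOME/decomp-res-lens-2/g24/CuspCut.lean` lines 5–110
and NODE-g24.md 5a47691c — not repeated here.]

## This file

§E.0 RING LEVEL (any commutative ring; `section CuspRing`): the CUSP LETTERS `EdgeAbove`, `RelCusp` (regular OR one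
coprime Newton edge `(a,b)`, `a,b ≥ 2`), `CuspShape` (= g19 `SpreadShape` at marking `n = 2`, `m = 2q+1`, with
`RelCusp` for `RelSimple`); kernels `relCusp_of_relSimple`, `cuspShape_of_spreadShape`, `eq_span_X_sup_map`,
`relCusp_X_pow_add_C_pow` (THE LETTER OF THE INHABITANT `X^a + t^b`), `cuspShape_pure`; §E.0b the INSEP-v³ TOWER
`insepV3_frame` / `insepV3_stage1` / `insepV3_stage2`; §E.0c `section Pilot` — THE KERNEL CERTIFICATE OF THE
INHABITANT's EXIT PACKAGE (the complete blow-up tree of the ω-game run by rule 𝓡 on `F = u s⁵ + u t³ + u³`: 39 chart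
identities `pilot_e<k>` and 21 leaf certificates `pilot_leaf<k>`, exact over ℤ or modulo `2 = 0`); §E.0d `section
Corner` — the TAME PILOT corner39 (residue characteristic 3; 15 identities).  Continued in `CuspCutKernels2`… where
the 400-line cap cuts.  (The 400-line cap cuts this group into 3 files; this first part carries: `EdgeAbove`,
`RelCusp`, `CuspShape`, `relCusp_of_relSimple`, `cuspShape_of_spreadShape`, `eq_span_X_sup_map`,
`relCusp_X_pow_add_C_pow`, `cuspShape_pure`, `insepV3_frame`, `insepV3_stage1`, `insepV3_stage2`, `insepV3_upper`,
`pilot_root_fat`, `pilot_root_top`, `pilot_zroot`.)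

[WRITER NOTE (decomp-res writer g13): file split only (tree files ≤ 400 lines); sections, section variables / opens
and every declaration exactly as in the lens (the node's HOME-only dupNamespace-linter line is dropped; the
namespace-level `open` lines of the node are replayed in every part, the `open …Theses` line only in the Theses-cone
file `MaxContactCutCuspCut`); namespace renamed `…Theses.CuspCut` ↦ `…Theorems.CuspCut`.]

(Sources: Hironaka1964 Ch. III; CossartJannsenSaito2020 Thm 5.9, Ch. 2, Ch. 8–9; Cutkosky2009 Thm 5.6, Thm 7.2,
Lemma 7.3, §8; Kollar2007 §3.13 (3.111); CossartPiltant2008 Prop. 4.2; CossartPiltant2019 Rem. 3.2;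
EncinasVillamayor2000; BierstoneGrigorievMilmanWlodarczyk2011 §3.1; Moh1987; Hauser2010Kangaroo; Giraud1975.)
-/

open CategoryTheory AlgebraicGeometry TopologicalSpace IsLocalRing
open Literature.AlgebraicGeometry.Resolution
open Summit.ResolutionOfSingularities.ResolutionOfSingularities.Theorems
open Summit.ResolutionOfSingularities.ResolutionOfSingularities.Theorems.WeakOrderReduction
open Summit.ResolutionOfSingularities.ResolutionOfSingularities.Theorems.DeltaFaceCutClasses
open Summit.ResolutionOfSingularities.ResolutionOfSingularities.Theorems.RelativeDeltaCut
open Summit.ResolutionOfSingularities.ResolutionOfSingularities.Theorems.CurveLeafExit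
open Summit.ResolutionOfSingularities.ResolutionOfSingularities.Theorems.PinchCut
open Summit.ResolutionOfSingularities.ResolutionOfSingularities.Theorems.JetCut
open Summit.ResolutionOfSingularities.ResolutionOfSingularities.Theorems.PurityCut
open Summit.ResolutionOfSingularities.ResolutionOfSingularities.Theorems.SplitCut
open Summit.ResolutionOfSingularities.ResolutionOfSingularities.Theorems.CylinderCut
open Summit.ResolutionOfSingularities.ResolutionOfSingularities.Theorems.SpreadCut
open Summit.ResolutionOfSingularities.ResolutionOfSingularities.Theorems.CrossCut
open Summit.ResolutionOfSingularities.ResolutionOfSingularities.Theorems.DeepCrossCut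
open Summit.ResolutionOfSingularities.ResolutionOfSingularities.Theorems.OddCrossCut

namespace Summit.ResolutionOfSingularities.ResolutionOfSingularities.Theorems.CuspCut

section CuspRing

variable {R : Type} [CommRing R]

/-! ## §E.0  RING LEVEL — the cusp letters, the inhabitant's letter, the INSEP-v³ tower (0 sorry) -/

/-- **EDGE-ABOVE ideal** `EdgeAbove s t a b` — spanned by the monomials `sⁱ tʲ` STRICTLY ABOVE the Newton edge
joining `(a,0)` and `(0,b)`: `b·i + a·j > a·b`.  DEFINITION (NEW object, support). [folklore] -/
def EdgeAbove {S : Type} [CommRing S] (s t : S) (a b : ℕ) : Ideal S :=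
  Ideal.span {x | ∃ i j : ℕ, a * b < b * i + a * j ∧ x = s ^ i * t ^ j}

/-- **RELATIVE CUSP-OR-SIMPLE over the curve** `RelCusp P M φ` (`P = 𝔭` the curve prime, `M = 𝔪_y`): at every
closed point `N` of the fibre line `M·R[X]` containing `φ`, EITHER the `C`-relative secondary curve `V(φ̄) ⊂ 𝔸¹_A`
(`A = R/𝔭 = 𝒪_{C,y}`) is regular there (g19's `RelSimple` reading `φ ∉ N² + 𝔭R[X]`), OR it has there ONE COPRIME
NEWTON EDGE: `N = (σ) + 𝔪_y R[X]`, `𝔪_y = (t) + 𝔭` (`t̄` a uniformiser of `A`), and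
`φ ≡ e₁σᵃ + e₂tᵇ (mod EdgeAbove σ t a b + 𝔭R[X])` with `e₁, e₂ ∉ N` (units at `N`), `a, b ≥ 2` coprime — a
unibranch CUSP of the secondary curve with rational tangent.  The E** letter.  DEFINITION (NEW class predicate).
(Sources: CossartJannsenSaito2020 Ch. 2; Moh1987; folklore (Newton–Puiseux over a DVR).) -/
def RelCusp (P M : Ideal R) (φ : Polynomial R) : Prop :=
  ∀ N : Ideal (Polynomial R), N.IsMaximal → Ideal.map (Polynomial.C : R →+* Polynomial R) M ≤ N → φ ∈ N →
    φ ∉ N ^ 2 ⊔ Ideal.map (Polynomial.C : R →+* Polynomial R) P ∨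
      ∃ (a b : ℕ) (σ e₁ e₂ : Polynomial R) (t : R), 2 ≤ a ∧ 2 ≤ b ∧ Nat.Coprime a b ∧
        N = Ideal.span {σ} ⊔ Ideal.map (Polynomial.C : R →+* Polynomial R) M ∧
        M = Ideal.span {t} ⊔ P ∧ e₁ ∉ N ∧ e₂ ∉ N ∧
        φ - (e₁ * σ ^ a + e₂ * Polynomial.C t ^ b) ∈
          EdgeAbove σ (Polynomial.C t) a b ⊔ Ideal.map (Polynomial.C : R →+* Polynomial R) P

/-- **CUSP SHAPE** `CuspShape P M c G g f m` (marking `2`): `f = z̃² + binForm u₁ u₂ G m + g`, tail `g` STRICTLY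
ABOVE the face (`g ∈ Q(2m+1)`), `m = 2q + 1`, `q ≥ 1`, and the secondary curve CUSP-OR-SIMPLE over `y` in both
charts.  g19's `SpreadShape … 2 m` with `RelCusp` for `RelSimple`.  DEFINITION (NEW class predicate).
(Sources: Hironaka1967; CossartJannsenSaito2020 Ch. 8; CossartPiltant2008 Prop. 4.2.) -/
def CuspShape (P M : Ideal R) (c : Fin 3 → R) (G : ℕ → R) (g f : R) (m : ℕ) : Prop :=
  f = c 0 ^ 2 + binForm (c 1) (c 2) G m + g ∧ g ∈ qWeighted c m 2 (2 * m + 1) ∧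
    (∃ q : ℕ, 1 ≤ q ∧ m = 2 * q + 1) ∧ RelCusp P M (lowerChart G m) ∧ RelCusp P M (upperChart G m)

/-- A relatively simple face is cusp-or-simple (the spread letter implies the cusp letter).  KERNEL (PROVED).
[folklore] -/
theorem relCusp_of_relSimple {P M : Ideal R} {φ : Polynomial R} (h : RelSimple P M φ) : RelCusp P M φ :=
  fun N hN hMN hφ => Or.inl (h N hN hMN hφ)

/-- **THE SPREAD CLASS IS INSIDE THE CUSP CLASS** at marking `2`: `SpreadShape P M c G g f 2 m → CuspShape P M c G g
f m`.  KERNEL (PROVED). [folklore] -/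
theorem cuspShape_of_spreadShape {P M : Ideal R} {c : Fin 3 → R} {G : ℕ → R} {g f : R} {m : ℕ}
    (h : SpreadShape P M c G g f 2 m) : CuspShape P M c G g f m := by
  obtain ⟨hf, hg, ⟨q, hq, hmq⟩, hl, hu⟩ := h
  refine ⟨hf, ?_, ⟨q, hq, by omega⟩, relCusp_of_relSimple hl, relCusp_of_relSimple hu⟩
  have h2m : 2 * m + 1 = m * 2 + 1 := by ring
  rw [h2m]
  exact hg

/-- A maximal ideal `N` of `R[X]` containing `𝔪·R[X]` (`𝔪` maximal in `R`) and `X` IS `(X) + 𝔪R[X]`.  KERNEL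
(PROVED; evaluation at `0`). [folklore] -/
theorem eq_span_X_sup_map {M : Ideal R} (hM : M.IsMaximal) {N : Ideal (Polynomial R)} (hN : N.IsMaximal)
    (hMN : Ideal.map (Polynomial.C : R →+* Polynomial R) M ≤ N) (hX : (Polynomial.X : Polynomial R) ∈ N) :
    N = Ideal.span {(Polynomial.X : Polynomial R)} ⊔ Ideal.map (Polynomial.C : R →+* Polynomial R) M := by
  apply le_antisymm
  · intro p hp
    have hdvd : (Polynomial.X : Polynomial R) ∣ p - Polynomial.C (p.eval 0) := by
      rw [Polynomial.X_dvd_iff]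
      simp [Polynomial.coeff_zero_eq_eval_zero]
    obtain ⟨r, hr⟩ := hdvd
    have hCx : Polynomial.C (p.eval 0) ∈ N := by
      have h1 : Polynomial.C (p.eval 0) = p - Polynomial.X * r := by rw [← hr]; ring
      rw [h1]
      exact N.sub_mem hp (N.mul_mem_right r hX)
    have hev : p.eval 0 ∈ M := by
      by_contra hc
      obtain ⟨y, i, hi, hyi⟩ := hM.exists_inv hc
      apply hN.ne_top
      rw [Ideal.eq_top_iff_one]
      have h1 : (1 : Polynomial R) = Polynomial.C y * Polynomial.C (p.eval 0) + Polynomial.C i := by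
        rw [← Polynomial.C_mul, ← Polynomial.C_add, hyi, Polynomial.C_1]
      rw [h1]
      exact N.add_mem (N.mul_mem_left _ hCx) (hMN (Ideal.mem_map_of_mem _ hi))
    have hp' : p = Polynomial.X * r + Polynomial.C (p.eval 0) := by rw [← hr]; ring
    rw [hp']
    exact Ideal.add_mem _ (Ideal.mem_sup_left (Ideal.mem_span_singleton'.mpr ⟨r, by ring⟩))
      (Ideal.mem_sup_right (Ideal.mem_map_of_mem _ hev))
  · refine sup_le ?_ hMN
    rw [Ideal.span_le, Set.singleton_subset_iff]
    exact hX

/-- **THE LETTER OF THE INHABITANT** [KERNEL (PROVED), any commutative ring, `M` maximal with `M = (t) + P`]: the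
lower chart `X^a + t^b` (`a, b ≥ 2` coprime) of a pure secondary form `u₁^a + t^b·u₂^a` is CUSP-OR-SIMPLE over the
curve — at its unique point `N = (X) + 𝔪R[X]` over `y` the cusp letter holds with `σ = X`, `e₁ = e₂ = 1` and
nothing above the edge.  INSEP-v³: `a = m = 5`, `t = v`, `b = 3` (g19 `represent_INSEPv3`: secondary form
`u₁⁵ + v³u₂⁵`, `lowerChart_pureCoeff`).  This is the step g19's `relSimple_X_pow_add_C` could not take
(`v³ ∈ 𝔪²`, `not_relSimple_X_pow_add_C_of_mem_sq`). [folklore] -/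
theorem relCusp_X_pow_add_C_pow {P M : Ideal R} (hM : M.IsMaximal) {t : R}
    (hMt : M = Ideal.span {t} ⊔ P) {a b : ℕ} (ha : 2 ≤ a) (hb : 2 ≤ b) (hab : Nat.Coprime a b) :
    RelCusp P M (Polynomial.X ^ a + Polynomial.C (t ^ b)) := by
  intro N hN hMN hφ
  have htM : t ∈ M := by
    rw [hMt]
    exact Ideal.mem_sup_left (Ideal.mem_span_singleton_self t)
  have hCt : Polynomial.C (t ^ b) ∈ N :=
    hMN (Ideal.mem_map_of_mem _ (M.pow_mem_of_mem htM b (by omega)))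
  have hX : (Polynomial.X : Polynomial R) ∈ N := by
    refine hN.isPrime.mem_of_pow_mem a ?_
    have h := N.sub_mem hφ hCt
    rwa [add_sub_cancel_right] at h
  have h1N : (1 : Polynomial R) ∉ N := fun h => hN.ne_top ((Ideal.eq_top_iff_one _).mpr h)
  refine Or.inr ⟨a, b, Polynomial.X, 1, 1, t, ha, hb, hab, eq_span_X_sup_map hM hN hMN hX, hMt, h1N, h1N, ?_⟩
  have h0 : Polynomial.X ^ a + Polynomial.C (t ^ b) -
      (1 * Polynomial.X ^ a + 1 * Polynomial.C t ^ b) = (0 : Polynomial R) := by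
    rw [Polynomial.C_pow]; ring
  rw [h0]
  exact Ideal.zero_mem _

/-- **PURE CUSP SHAPE** [KERNEL (PROVED)]: `f = z̃² + (u₁^m + t^b·u₂^m) + g`, `g ∈ Q(2m+1)`, `m = 2q+1`, `q ≥ 1`,
`b ≥ 2` coprime to `m`, `𝔪 = (t) + 𝔭` — CUSP SHAPE with `G = pureCoeff (t^b) m` (lower chart by
`relCusp_X_pow_add_C_pow`, upper chart `1 + t^b X^m` a unit along the fibre).  INSEP-v³ in the frame
`z̃ = z + v(u₁+u₂)`: `m = 5`, `q = 2`, `t = v`, `b = 3`, `g = u₂⁷`. [folklore] -/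
theorem cuspShape_pure {P M : Ideal R} (hM : M.IsMaximal) (c : Fin 3 → R) {t g f : R} {m q b : ℕ}
    (hq : 1 ≤ q) (hm : m = 2 * q + 1) (hb : 2 ≤ b) (hmb : Nat.Coprime m b) (hMt : M = Ideal.span {t} ⊔ P)
    (hf : f = c 0 ^ 2 + (c 1 ^ m + t ^ b * c 2 ^ m) + g) (hg : g ∈ qWeighted c m 2 (2 * m + 1)) :
    CuspShape P M c (pureCoeff (t ^ b) m) g f m := by
  have hm0 : m ≠ 0 := by omega
  refine ⟨by rw [binForm_pureCoeff _ _ _ hm0, hf], hg, ⟨q, hq, hm⟩, ?_, ?_⟩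
  · rw [lowerChart_pureCoeff (t ^ b) hm0]
    exact relCusp_X_pow_add_C_pow hM hMt (by omega) hb hmb
  · rw [upperChart_pureCoeff (t ^ b) hm0]
    refine relCusp_of_relSimple (relSimple_of_sub_one_mem P M _ ?_)
    rw [add_sub_cancel_left]
    have htM : t ^ b ∈ M := by
      rw [hMt]
      exact Ideal.mem_sup_left (Ideal.pow_mem_of_mem _ (Ideal.mem_span_singleton_self t) b (by omega))
    exact Ideal.mul_mem_right _ _ (Ideal.mem_map_of_mem _ htM)

/-! ### §E.0b  The INSEP-v³ tower (ring identities, any commutative ring) -/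

/-- **FRAME**: INSEP-v³ `(z + vU)² + u₁⁵ + v³u₂⁵ + u₂⁷` (`U = u₁+u₂`) in the frame coordinate `z̃ = z + v(u₁+u₂)` is
`z̃² + u₁⁵ + v³u₂⁵ + u₂⁷` (trivial, recorded for the reading).  KERNEL (PROVED). [folklore] -/
theorem insepV3_frame (z v u₁ u₂ : R) :
    (z + v * (u₁ + u₂)) ^ 2 + u₁ ^ 5 + v ^ 3 * u₂ ^ 5 + u₂ ^ 7 =
      (z + v * (u₁ + u₂)) ^ 2 + (u₁ ^ 5 + v ^ 3 * u₂ ^ 5) + u₂ ^ 7 := by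
  ring

/-- **STAGE 1** (blow up the top curve `C = V(z̃,u₁,u₂)`, chart `u₂`: `z̃ = z₁u`, `u₁ = wu`, `u₂ = u`): the total
transform is `u²·(z₁² + u³(w⁵ + v³ + u²))`.  KERNEL (PROVED). [folklore] -/
theorem insepV3_stage1 (z₁ v w u : R) :
    (z₁ * u) ^ 2 + (w * u) ^ 5 + v ^ 3 * u ^ 5 + u ^ 7 = u ^ 2 * (z₁ ^ 2 + u ^ 3 * (w ^ 5 + v ^ 3 + u ^ 2)) := by
  ring

/-- **STAGE 2** (blow up `Σ₁ = V(z₁,u)`, chart `u`: `z₁ = Zu`): the total transform is `u²·(Z² + F)` with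
`F = u·w⁵ + u·v³ + u³` — the ROOT of the pilot game (`s = w`, `t = v`).  KERNEL (PROVED). [folklore] -/
theorem insepV3_stage2 (Z v w u : R) :
    (Z * u) ^ 2 + u ^ 3 * (w ^ 5 + v ^ 3 + u ^ 2) = u ^ 2 * (Z ^ 2 + (u * w ^ 5 + u * v ^ 3 + u ^ 3)) := by
  ring

/-- **THE OTHER CHARTS OF THE TOWER carry no order-2 point over the curve**: stage 1 chart `u₁` (`u₂ = w′u₁`) gives
`u₁²·(z₁² + u₁³·(1 + v³w′⁵ + u₁²w′⁷))` and stage 2 over it `u₁²·(Z² + u₁·(1 + v³w′⁵ + u₁²w′⁷))` — `F` is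
`u₁ · unit` along `u₁ = 0`, of order `1` (g19 `relSimple_of_sub_one_mem` reading); the `Z`-charts carry no point
of the strict transform over the centre.  KERNEL (PROVED: the two identities). [folklore] -/
theorem insepV3_upper (z₁ Z v w' u₁ : R) :
    (z₁ * u₁) ^ 2 + u₁ ^ 5 + v ^ 3 * (w' * u₁) ^ 5 + (w' * u₁) ^ 7 =
        u₁ ^ 2 * (z₁ ^ 2 + u₁ ^ 3 * (1 + v ^ 3 * w' ^ 5 + u₁ ^ 2 * w' ^ 7)) ∧
      (Z * u₁) ^ 2 + u₁ ^ 3 * (1 + v ^ 3 * w' ^ 5 + u₁ ^ 2 * w' ^ 7) =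
        u₁ ^ 2 * (Z ^ 2 + u₁ * (1 + v ^ 3 * w' ^ 5 + u₁ ^ 2 * w' ^ 7)) := by
  constructor <;> ring

/-- **THE ROOT's τ = 1 LOCUS IS THE CUSP POINT ALONE.**  For `F = u s⁵ + u t³ + u³`: modulo `2`,
`∂_u F ≡ s⁵ + t³ + u²`, `∂_s F ≡ u s⁴`, `∂_t F ≡ u t²`, `D_us F ≡ s⁴`, `D_ut F ≡ t²`, `D_st F ≡ 0`; the identity
puts `u²` in the τ = 1 ideal `(∇F, D F) ∋ s⁴, t²`, whose radical is therefore `(u,s,t)`: the only τ = 1 point of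
the stage-`q` chart is the cusp point `x̄` (every other point of the curve exits at once).  KERNEL (PROVED). [folklore] -/
theorem pilot_root_fat (u s t : R) :
    (1 : R) * (s ^ 5 + t ^ 3 + u ^ 2) + (-s) * (s ^ 4) + (-t) * (t ^ 2) = u ^ 2 := by
  ring

/-- **TOP-ISOLATION OF THE PILOT** (the class hypothesis `IsTopIsolatedClosure` for the inhabitant, NODE-g24 §1.3):
with EXACT derivatives, `u·∂_uF + s·∂_sF + t·∂_tF = u³` given `2 = 0`, so `Top(Z² + F) = V(∇F) ⊆ {u = 0} = Σ̃_q`,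
where it is `V(u, s⁵ + t³)` = the cusp curve `Γ`: no other top component passes near `Γ` (the desk engine's
`legit` test, here in the kernel).  KERNEL (PROVED). [folklore] -/
theorem pilot_root_top (u s t : R) (h2 : (2 : R) = 0) :
    u * (s ^ 5 + t ^ 3 + 3 * u ^ 2) + s * (5 * u * s ^ 4) + t * (3 * u * t ^ 2) = u ^ 3 := by
  linear_combination (3 * u * s ^ 5 + 2 * u * t ^ 3 + u ^ 3) * h2

/-- **THE `Z`-CHART OF A CENTRE CARRIES NO POINT OVER IT** (root instance; NODE-g24 §2.1): in the chart `Z` of the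
blow-up of `x̄ = V(Z,u,s,t)` the weak transform of `Z² + F` is `1 + Z·(…)`, a unit along the exceptional divisor
`{Z = 0}` — the strict transform of the hypersurface misses the chart's exclusive point; for a curve centre
`V(Z,x_a,x_b)` the weak transform is `≡ 1 (mod x_a', x_b')` at the chart's exclusive points likewise.  So the
`u/s/t`-charts of the tree cover every point over every centre.  KERNEL (PROVED). [folklore] -/
theorem pilot_zroot (Z u s t : R) :
    Z ^ 2 + ((Z * u) * (Z * s) ^ 5 + (Z * u) * (Z * t) ^ 3 + (Z * u) ^ 3) =
      Z ^ 2 * (1 + Z * (Z ^ 3 * u * s ^ 5 + Z * u * t ^ 3 + u ^ 3)) := by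
  ring

end CuspRing

end Summit.ResolutionOfSingularities.ResolutionOfSingularities.Theorems.CuspCut
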